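import Mathlib.AlgebraicTopology.FundamentalGroupoid.SimplyConnected
import Literature.Geometry.Lorentzian.KillingHorizonShadowAlong
import Literature.Geometry.Lorentzian.AxisymmetricBlackHoleUniqueness
import HarnessLib

/-!
# Black-hole uniqueness ingredients at the level of the domain of outer communications
# (Chruściel 1997, Thm 1.1; Chruściel–Costa–Heusler 2012, Thm 3.2 as consumed in Chruściel–Costa 2008, §7.1)

Two NAMED FACTS (D-0014), companions of the carrier-level vendorings
`BeigChrusciel1997_axisymmetricCombination` (`KillingAlgebraAsymptoticallyFlat.lean`) and
`ChruscielCostaHeusler2012_axisymmetricUniqueness` (`AxisymmetricBlackHoleUniqueness.lean`), for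
the situation produced by a Hawking-type rigidity step: the second Killing field is known on the
domain of outer communications `⟨⟨M_ext⟩⟩` only (plus a horizon Killing field near `𝓔⁺`), not on the
whole carrier — which is exactly how the printed proofs proceed (Chruściel, CMP 189 (1997) Thm 1.1:
"the isometry group of `⟨⟨M_ext⟩⟩` … contains `ℝ × U(1)`", "no claims about isometries of
`M ∖ ⟨⟨M_ext⟩⟩` are made"; Chruściel–Costa 2008 Thm 4.14: Killing fields "on `⟨⟨M_ext⟩⟩ ∪ 𝓔⁺₀`",
completeness proved on `⟨⟨M_ext⟩⟩`, p. 17; §7.1 applies §§5–6 to `⟨⟨M_ext⟩⟩`).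

* `Chrusciel1997_docAxisymmetricCombination` — Chruściel 1997 Thm 1.1 at `𝒪 = ⟨⟨M_ext⟩⟩` (so that
  analyticity, used there only through Nomizu's extension theorem, is not needed): a second Killing
  field of `(⟨⟨M_ext⟩⟩, g|)` commuting with `T`, not a constant multiple of `T`, yields an
  axisymmetric combination `a T + b K` complete and `2π`-periodic in `⟨⟨M_ext⟩⟩` with an axis there.
* `ChruscielCostaHeusler2012_docAxisymmetricUniqueness` — CCH12 Thm 3.2 (vacuum, connected
  horizon) with "axisymmetric" read on `⟨⟨M_ext⟩⟩` and the horizon a non-degenerate Killing horizon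
  of `T + Ω Φ` for a horizon Killing field given near `𝓔⁺`: the d.o.c. is a sub-extremal Kerr
  exterior (`IsIsometricToKerrExterior`).

Both are `def … : Prop` (no `_holds` expected: these are the black-hole uniqueness theorems);
users take them as hypotheses.  Requested by the line lead of crux stmt-FinalStateConjecture-17840
(`ZeroEnergyKerrOrBomb.HawkingExtensionIsKerr`), whose registered skeleton closes the crux modulo
these two facts, `SudarskyWald1993_staticity`, `ChruscielGalloway2010_docStaticUniqueness` and one
surface-gravity stub.

## References

* P. T. Chruściel, *On rigidity of analytic black holes*, Commun. Math. Phys. 189 (1997) 1–7,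
  gr-qc/9610011, Thm. 1.1 and §2 (key `Chrusciel1997`).
* R. Beig, P. T. Chruściel, Commun. Math. Phys. 188 (1997) 585–597, Thm. 1.2, Props. 2.3–2.4
  (key `BeigChrusciel1997`).
* P. T. Chruściel, J. L. Costa, Astérisque 321 (2008) 195–265 = arXiv:0806.0016, Thm. 4.14 and
  p. 17, §5 (Thms. 5.4, 5.6), §6.1, §6.3, Cor. 6.3, §7.1 (key `ChruscielCosta2008`).
* P. T. Chruściel, J. L. Costa, M. Heusler, Living Rev. Relativity 15 (2012) 7 = arXiv:1205.6112,
  §3.2.1 (p. 10), Thm. 3.2 (§3.2.7, p. 11), §3.3.1 (p. 11) (key `ChruscielCostaHeusler2012`).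
-/

noncomputable section

open scoped Manifold ContDiff

namespace Literature.Geometry.Lorentzian

open Set Function

/-- **Chruściel 1997, Thm 1.1 at `𝒪 = ⟨⟨M_ext⟩⟩` (d.o.c.-level axisymmetric combination; named
fact, D-0014).**  P. T. Chruściel, *On rigidity of analytic black holes*, Commun. Math. Phys. 189
(1997) 1–7 = gr-qc/9610011, **Theorem 1.1**: "Consider an analytic space–time `(M, g)` with a
Killing vector field `X` with complete orbits. Suppose that `M` contains an asymptotically flat
three–end `Σ_ext` with time-like ADM four–momentum, and with `X` time-like on `Σ_ext`. Let
`⟨⟨M_ext⟩⟩` denote the domain of outer communications; assume that `⟨⟨M_ext⟩⟩` is globally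
hyperbolic and simply connected. If there exists a Killing vector field `Y`, which is not a
constant multiple of `X`, defined on an open subset `𝒪` of `⟨⟨M_ext⟩⟩`, then the isometry group of
`⟨⟨M_ext⟩⟩` (with the metric obtained from `(M, g)` by restriction) contains `ℝ × U(1)`" (and
Remark 4: "no claims about isometries of `M ∖ ⟨⟨M_ext⟩⟩` are made").  In the proof (§2) analyticity
is used exactly once, through Nomizu's theorem, to extend `Y` from `𝒪` to a Killing field `Ŷ` on
`⟨⟨M_ext⟩⟩`; the rest — Beig–Chruściel's asymptotic analysis (`Z = a X + b Ŷ` complete and periodic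
through the far region, with an axis, J. Math. Phys. 37 (1996) 1939 / Commun. Math. Phys. 188 (1997)
585 Thm 1.2, Props 2.3–2.4) and the causal "sandwich" giving completeness and periodicity of `Z` on
all of `⟨⟨M_ext⟩⟩` — is smooth.  Vendored, hypothesis by hypothesis, WEAKER than print: for a
`StationaryAFBlackHole` (`X = T = 𝓑.killing` complete, timelike on `M_ext ⊇ Σ_ext`; AF end) which is
vacuum and `I⁺`-regular with connected (non-empty) horizon (so `⟨⟨M_ext⟩⟩` is globally hyperbolic,
and the ADM four-momentum is timelike by the positive energy theorem — Chruściel–Costa–Heusler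
2012, §3.2.1 p. 10: "Assuming `I⁺`-regularity, one can invoke the positive energy theorem to show
[Beig–Chruściel] that some linear combination of the Killing vectors must have periodic orbits, and
an axis of rotation"), with `⟨⟨M_ext⟩⟩` simply connected (printed hypothesis), and a Killing field
`K` of `(⟨⟨M_ext⟩⟩, g|)` given on ALL of `𝒪 = ⟨⟨M_ext⟩⟩` (so Nomizu, hence analyticity, is not
needed) which commutes with `T` there (EXTRA) and is not a constant multiple of `T` on `⟨⟨M_ext⟩⟩`:
some combination `a T + b K`, `b ≠ 0`, has through every point of `⟨⟨M_ext⟩⟩` a whole-line integral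
curve staying in `⟨⟨M_ext⟩⟩` which is `2π`-periodic (print: "`ℝ × U(1)`"; the period is a choice of
the multiple), and vanishes somewhere in `⟨⟨M_ext⟩⟩` (the axis, Beig–Chruściel 1997 Prop 2.4, lies
in the asymptotic region `⊆ ⟨⟨M_ext⟩⟩`).  This is also the completeness step printed in
Chruściel–Costa 2008 (arXiv:0806.0016), proof of Thm 4.14, p. 17.
[cite: Chrusciel1997, Thm. 1.1 and its proof (§2)]
[cite: BeigChrusciel1997, Thm. 1.2, Props. 2.3–2.4]
[cite: ChruscielCostaHeusler2012, §3.2.1 (p. 10) and §3.3.1 (p. 11)]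
-/
def Chrusciel1997_docAxisymmetricCombination : Prop :=
  ∀ (𝓑 : StationaryAFBlackHole.{0}) [𝓑.metric.HasLeviCivita],
    𝓑.metric.toPseudoRiemannianMetric.IsRicciFlat → 𝓑.IsIPlusRegular → IsConnected 𝓑.horizon →
    SimplyConnectedSpace 𝓑.doc →
    ∀ K : Π x : 𝓑.carrier, TangentSpace (𝓡 4) x,
      𝓑.metric.toPseudoRiemannianMetric.IsKillingFieldOn K 𝓑.doc →
      (∀ x ∈ 𝓑.doc, VectorField.mlieBracket (𝓡 4) 𝓑.killing K x = 0) →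
      (¬ ∃ c : ℝ, ∀ x ∈ 𝓑.doc, K x = c • 𝓑.killing x) →
      ∃ a b : ℝ, b ≠ 0 ∧
        (∀ x ∈ 𝓑.doc, ∃ γ : ℝ → 𝓑.carrier, IsMIntegralCurve γ (a • 𝓑.killing + b • K) ∧
          γ 0 = x ∧ (∀ t, γ t ∈ 𝓑.doc) ∧ Function.Periodic γ (2 * Real.pi)) ∧
        ∃ x ∈ 𝓑.doc, (a • 𝓑.killing + b • K) x = 0

/-- **Chruściel–Costa–Heusler 2012, Thm 3.2 (vacuum, connected non-degenerate horizon),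
transcribed at the level of `⟨⟨M_ext⟩⟩ ∪ 𝓔⁺` (named fact, D-0014).**  Printed: "Let `(M, g)` be a
stationary, axisymmetric asymptotically-flat, `I⁺`-regular, electrovacuum four-dimensional
spacetime. Then the domain of outer communications `⟨⟨M_ext⟩⟩` is isometric to one of the Weinstein
solutions. In particular, if the event horizon is connected, then `⟨⟨M_ext⟩⟩` is isometric to the
domain of outer communications of a Kerr–Newman spacetime" (Living Rev. Relativity 15 (2012) 7,
§3.2.7, p. 11); proof Chruściel–Costa 2008 (arXiv:0806.0016) §§5–7, where the `ℝ × U(1)` action is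
CONSUMED on `⟨⟨M_ext⟩⟩` (Thms 5.4/5.6, §6.1 "the orbit space `⟨⟨M_ext⟩⟩/(ℝ × U(1))`", §7.1) together
with the structure of `𝓔⁺` as a non-degenerate Killing horizon of `K₀ + Ω K₁` with the horizon
Killing field defined near `𝓔⁺` (output of Thm 4.14: Killing fields "on `⟨⟨M_ext⟩⟩ ∪ 𝓔⁺₀`";
§6.3 "all horizons non-degenerate"; Cor 6.3: "no non-degenerate axisymmetric vacuum black holes
with `|a| ≥ m` exist").  Vendored, hypothesis by hypothesis (each implies the printed one, or is
EXTRA): `𝓑 : StationaryAFBlackHole` (stationary, AF, four-dimensional), `I⁺`-regular, connected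
horizon, vacuum (`⊆` electrovacuum), `⟨⟨M_ext⟩⟩` simply connected (EXTRA; a theorem in print,
CC08 Cor 2.x); AXISYMMETRY: a Killing field `Φ` of `(⟨⟨M_ext⟩⟩, g|)` commuting with `T`, complete
in `⟨⟨M_ext⟩⟩` with all orbits `2π`-periodic, non-trivial, with non-empty axis there (this is
"`Isom(⟨⟨M_ext⟩⟩, g|) ⊇ ℝ × U(1)`", the conclusion of Chruściel 1997 Thm 1.1 / CC08 Thm 4.14 used in
CC08 §7.1); NON-DEGENERATE KILLING HORIZON: a Killing field `χ` on an open `U ⊇ 𝓔⁺` equal to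
`T + Ω Φ` on `U ∩ ⟨⟨M_ext⟩⟩`, nowhere zero on `𝓔⁺`, tangent to `𝓔⁺` (whole-line integral curves from
`𝓔⁺` stay in `𝓔⁺`, the tree's rendering in `IsNonDegenerateHorizon`) with `∇_χ χ = κ χ` on `𝓔⁺`,
`κ ≠ 0` constant (hence `χ` null on `𝓔⁺`; CC08 §2.3–2.5, (2.8)) — the EXTRA non-degeneracy is what
makes the Kerr member sub-extremal, exactly as in the tree's carrier-level vendoring
`ChruscielCostaHeusler2012_axisymmetricUniqueness`, of which this is the `⟨⟨M_ext⟩⟩`-level form.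
Conclusion: `IsIsometricToKerrExterior` (sub-extremal).  Not vendored: electrovacuum, Weinstein
multi-hole solutions, the degenerate case (Chruściel–Nguyen 2010).
[cite: ChruscielCostaHeusler2012, Thm. 3.2 (§3.2.7, p. 11), §3.2.1 (p. 10), §3.3.1 (p. 11)]
[cite: ChruscielCosta2008, Thm. 4.14 and p. 17, §5 (Thms. 5.4, 5.6), §6.1, §6.3, Cor. 6.3, §7.1]
-/
def ChruscielCostaHeusler2012_docAxisymmetricUniqueness : Prop :=
  ∀ (𝓑 : StationaryAFBlackHole.{0}) [𝓑.metric.HasLeviCivita] [Kerr.Facts]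
    (hF : 𝓑.metric.isOpen_chronologicalFuture 𝓑.timeOrientation)
    (hP : 𝓑.metric.isOpen_chronologicalPast 𝓑.timeOrientation)
    (hres : PseudoRiemannianMetric.contMDiff_restrict (I := 𝓡 4) (n := ∞) (M := 𝓑.carrier)),
    𝓑.IsIPlusRegular → IsConnected 𝓑.horizon → 𝓑.metric.toPseudoRiemannianMetric.IsRicciFlat →
    SimplyConnectedSpace 𝓑.doc →
    ∀ (Φ : Π x : 𝓑.carrier, TangentSpace (𝓡 4) x),
      𝓑.metric.toPseudoRiemannianMetric.IsKillingFieldOn Φ 𝓑.doc →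
      (∀ x ∈ 𝓑.doc, VectorField.mlieBracket (𝓡 4) 𝓑.killing Φ x = 0) →
      (∀ x ∈ 𝓑.doc, ∃ γ : ℝ → 𝓑.carrier, IsMIntegralCurve γ Φ ∧ γ 0 = x ∧
        (∀ t, γ t ∈ 𝓑.doc) ∧ Function.Periodic γ (2 * Real.pi)) →
      (∃ x ∈ 𝓑.doc, Φ x = 0) → (∃ x ∈ 𝓑.doc, Φ x ≠ 0) →
      ∀ (U : Set 𝓑.carrier) (χ : Π x : 𝓑.carrier, TangentSpace (𝓡 4) x) (Ω κ : ℝ),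
        IsOpen U → 𝓑.horizon ⊆ U → 𝓑.metric.toPseudoRiemannianMetric.IsKillingFieldOn χ U →
        (∀ x ∈ U ∩ 𝓑.doc, χ x = 𝓑.killing x + Ω • Φ x) →
        (∀ p ∈ 𝓑.horizon, χ p ≠ 0) →
        (∀ γ : ℝ → 𝓑.carrier, IsMIntegralCurve γ χ → γ 0 ∈ 𝓑.horizon → ∀ t, γ t ∈ 𝓑.horizon) →
        κ ≠ 0 → (∀ p ∈ 𝓑.horizon, 𝓑.metric.leviCivita χ p (χ p) = κ • χ p) →
        𝓑.IsIsometricToKerrExterior hF hP hres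


/-- Hypothesis form of `Chrusciel1997_docAxisymmetricCombination`: given the named fact, a second
Killing field of the d.o.c. of an `I⁺`-regular vacuum hole with connected horizon and simply
connected d.o.c., commuting with `T` and not a multiple of `T` there, has an axisymmetric
combination in the d.o.c.  Tautological unfolding. Chruściel 1997, Thm. 1.1.
[cite: Chrusciel1997, Thm. 1.1] -/
theorem Chrusciel1997_docAxisymmetricCombination.apply
    (h : Chrusciel1997_docAxisymmetricCombination) (𝓑 : StationaryAFBlackHole.{0})
    [𝓑.metric.HasLeviCivita] (hvac : 𝓑.metric.toPseudoRiemannianMetric.IsRicciFlat)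
    (hreg : 𝓑.IsIPlusRegular) (hconn : IsConnected 𝓑.horizon) (hsc : SimplyConnectedSpace 𝓑.doc)
    {K : Π x : 𝓑.carrier, TangentSpace (𝓡 4) x}
    (hK : 𝓑.metric.toPseudoRiemannianMetric.IsKillingFieldOn K 𝓑.doc)
    (hTK : ∀ x ∈ 𝓑.doc, VectorField.mlieBracket (𝓡 4) 𝓑.killing K x = 0)
    (hrot : ¬ ∃ c : ℝ, ∀ x ∈ 𝓑.doc, K x = c • 𝓑.killing x) :
    ∃ a b : ℝ, b ≠ 0 ∧
      (∀ x ∈ 𝓑.doc, ∃ γ : ℝ → 𝓑.carrier, IsMIntegralCurve γ (a • 𝓑.killing + b • K) ∧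
        γ 0 = x ∧ (∀ t, γ t ∈ 𝓑.doc) ∧ Function.Periodic γ (2 * Real.pi)) ∧
      ∃ x ∈ 𝓑.doc, (a • 𝓑.killing + b • K) x = 0 :=
  h 𝓑 hvac hreg hconn hsc K hK hTK hrot

end Literature.Geometry.Lorentzian

end
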